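import Literature.MathematicalPhysics.QuantumFieldTheory.Balaban1983to89.B9Thm37AllNorms

/-!
# `Balaban1983to89.B9Thm37AllNormsRight` — [B9] Theorem 3.7 and Corollary 3.8 (pp. 408–410) for the RIGHT members of
# (3.42)–(3.47): the transposed walk G′ = Σₙ Vⁿ G′₀ summed with ARBITRARY block norms at both ends of an operator
# applied on the input side of G′ (G′∇*_U of (3.42)₃, ‖hG′∇*_Uλ‖ of (3.46)₃, …) — sequel of `…B9Thm37AllNorms`

T. Bałaban, *Propagators for lattice gauge theories in a background field*, Commun. Math. Phys. **99**, 389–434 (1985)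
[Balaban1985BackgroundPropagators] (cell paper B9; journal page = PDF page + 388); [4] = [Balaban1984PropagatorsII],
[3] = [Balaban1984PropagatorsI] (Commun. Math. Phys. **96** (1984) 223–250 and **95** (1984) 17–40).

statement-level skeleton of published theorems with citation tags; proofs where landed; nothing here is a claim about the Yang–Mills mass gap

CITATION HEADER (lean-in-tree rule).  THE PRINTED LOCI are those certified in the headers of `…B9Thm37Sum` and
`…B9Thm37AllNorms`: Theorem 3.7 with (3.87)–(3.90) p. 409 [PDF 21], its proof and Corollary 3.8 (3.91)–(3.94) p. 410
[PDF 22] (*"The expansion is convergent in all norms appearing in the inequalities (3.42)–(3.47)"*; *"Similar estimates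
hold for the other norms"*), the right members among (3.42)–(3.47) pp. 397–398 [PDF 9–10]: *"|(G′(U)∇*_Uλ)(x)| ≤
B₀L^jηe^{−δ₀d(y,y′)}|λ|"* ((3.42)₃), *"‖hG′(U)∇*_Uλ‖"* ((3.46)₃), and the remark p. 398: *"the choice of derivatives
∇_U, ∇*_U is conventional, we may always replace ∇_U by ∇*_U, and vice versa, in arbitrary place and combination. Next,
the choice of powers L^jη is conventional also. Using Lemma 2.1 in [4] we may replace the factor (L^jη)^α by
(L^jη)^β(L^{j′}η)^γ with β + γ = α"*.  The TRANSPOSED EXPANSION is the reading of `…B9Thm37Glue` (v4, cell record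
D-pv21g5.2): Δ′_aG′ = I and the transpose of (3.88), G′₀Δ′_a = I − V with V = Σ_□h_□G′_□K(h_□)ᵗ, give the LEFT fixed
point G′ = G′₀ + VG′ (`B9Thm37Glue.fixedPoint_of_388T`), closed on every right member G′A: G′A = G′₀A + V(G′A).

WHAT THIS FILE CERTIFIES (0 sorry; theorems only; no `def`, no new named fact).  Block norms `b₀` (the input of A, a
space F₀: bond functions for A = ∇*_U, or the λ-space with another local size), `b₁` (where G′, V act: F₁) in the
vocabulary of `…B11SectG`; weights W > 0 (output, L^jη …) and Q ≥ 0 (input) as in the p. 398 remark.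
* §1 tools: chains of CONJUGATED kernels (W(y)/W(y′))·w(y,y′) telescope (`chain_conj`, `lchain_conj`); the column
  convolution with a symmetric distance (`conv_weight_col_le`).
* §2 **`neumann_left_weighted`** — the LEFT Neumann series A₀ = S + VA₀ over block norms with V majorised in `b₁` by
  θ(W(y)/W(y′))e^{−δ₀d} (the shape the transposed (3.89) delivers: `B9Thm37Glue.rightR_cube_majorant`) and S from `b₀`
  into `b₁` by AW(y)Q(y′)e^{−δ₀d}: A₀ has majorant Ac₁(α)(1 − κ₁θc₁(α))⁻¹W(y)Q(y′)e^{−(1−α)δ₀d} (d symmetric, Lemma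
  2.1 at α, a-priori constant bound).  Companion of `B11SectG.neumann_majorant` (constant weights) and of
  `B6RandomWalkHom.hom_majorant_of_leftFixedPoint` (sup sizes).
* §3 **`thm37_right`** — THEOREM 3.7 FOR A RIGHT MEMBER G′A FROM `b₀` INTO `b₁`: from the legs h_□G′_□h_□A (the
  A-member of Corollary 3.6 for G′_□, localized to S_□: 1_{S_□}(y)AW(y)Q(y′)e^{−δ₀d} — `hlegR`), the transposed (3.89)
  terms V_□ = h_□G′_□K(h_□)ᵗ (1_{S_□}(y)θ(W(y)/W(y′))e^{−δ₀d} in `b₁` — `hV`), overlap ≤ N, Δ′_aG′ = I and the transposed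
  (3.88) summed (`h388T`), Lemma 2.1 and κ₁Nθc₁(α) < 1: G′A has majorant NAc₁(α)(1 − κ₁Nθc₁(α))⁻¹W(y)Q(y′)
  e^{−(1−α)δ₀d(y,y′)}; **`thm37_right_explicit`** (*"M sufficiently large"*: θ = θ₀M⁻¹, M ≥ 2κ₁Nθ₀c₁(α), constant
  2NAc₁(α)).
* §4 the transposed walk: `hasMaj_lprod_right` ((3.91) for V_{□_m}⋯V_{□₀}·(h G′_□ h A): products in `b₁` followed
  by the leg from `b₀`) and **`walkSum_weighted`**, the Proposition 1.2 [3] walk count with input and output weights.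

HONEST SCOPE.  As in `…B9Thm37AllNorms`: the legs, the transposed (3.89) and (3.88)ᵗ are INPUTS of the printed shape
(`…B9Thm37Glue` v4 derives them in the sup sizes from (3.42)₁,₃ for G′_□, the coefficient kernels of K(h_□)ᵗ with their
column sums and the cube comparability L^jη ≤ C_ℓL^{j′}η); the a-priori bound `hap` is an input for abstract norms; the
distance is assumed SYMMETRIC (d of [4] (2.46) is) so that Lemma 2.1's row sum serves as a column sum and the rate
stays (1 − α)δ₀; two-sided members ((3.44)–(3.45), (3.46)₄) are NOT here (next file).  Value = kernel-checked
bookkeeping of a printed *"we will not repeat them here"*, NOT summit progress; nothing continuum, nothing about the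
mass gap.  Seat `pub-ymgap-dag-n06-b` (HUMAN RULING D-0062, node N06), 2026-08-25; rows B9.Thm3.7 × B9.Cor3.8 ×
(3.42)₃/(3.46)₃/(3.47) (cells only).
-/

namespace Literature.MathematicalPhysics.QuantumFieldTheory.Balaban1983to89.B9Thm37AllNormsRight

open Literature.MathematicalPhysics.QuantumFieldTheory.Balaban1983to89
open Finset B6RandomWalk B9Thm37Sum B11SectG B9Thm37AllNorms

noncomputable section

/-! ## §1  Conjugated chains and the column convolution -/

section Tools

variable {G : B6.Geometry}

omit G in
/-- Chains of conjugated kernels telescope: `chain ((W y/W y′)·w) m y y′ = (W y/W y′)·chain w m y y′` (W ≠ 0).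
[cite: Balaban1984PropagatorsII, (2.52) p.232] -/
theorem chain_conj {S : Type} [Fintype S] (W : S → ℝ) (hW : ∀ a, W a ≠ 0) (w : S → S → ℝ) (m : ℕ) (y y' : S) :
    chain (fun a c => W a / W c * w a c) m y y' = W y / W y' * chain w m y y' := by
  induction m generalizing y with
  | zero => simp
  | succ m ih =>
      rw [chain_succ, chain_succ, Finset.mul_sum]
      refine Finset.sum_congr rfl fun z _ => ?_
      rw [ih z]
      have hz := hW z
      field_simp

omit G in
/-- The same for the walk chains `B9Thm37Sum.lchain` with a family of kernels. [cite: Balaban1985BackgroundPropagators, (3.91) p.410] -/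
theorem lchain_conj {S : Type} [Fintype S] (W : S → ℝ) (hW : ∀ a, W a ≠ 0) :
    ∀ (n : ℕ) (K : ℕ → S → S → ℝ) (y y' : S),
      lchain (fun i a c => W a / W c * K i a c) n y y' = W y / W y' * lchain K n y y'
  | 0, K, y, y' => rfl
  | n + 1, K, y, y' => by
      show ∑ z, W y / W z * K 0 y z * lchain (fun i a c => W a / W c * K (i + 1) a c) n z y' =
        W y / W y' * ∑ z, K 0 y z * lchain (fun i => K (i + 1)) n z y'
      rw [Finset.mul_sum]
      refine Finset.sum_congr rfl fun z _ => ?_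
      rw [lchain_conj W hW n (fun i => K (i + 1)) z y']
      have hz := hW z
      field_simp

/-- **The column convolution with a symmetric distance**: Σ_{y″} r·e^{−(1−α)δ₀d(y,y″)}·A·e^{−δ₀d(y″,y′)} ≤
r·A·c₁(α)·e^{−(1−α)δ₀d(y,y′)} — split the second factor, the triangle inequality (2.54), and the row sum (2.61) at y′
read as a column sum by the symmetry of d. [cite: Balaban1984PropagatorsII, (2.54) p.233, (2.61) p.234] -/
theorem conv_weight_col_le (d : ℕ) (δ₀ α r A : ℝ) (hr : 0 ≤ r) (hA : 0 ≤ A) (h1αδ : 0 ≤ (1 - α) * δ₀)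
    (htri : Triangle254 G) (hsymm : ∀ a c : G.Site, G.dist a c = G.dist c a) (h261 : Ineq261 d G δ₀ α)
    (a c : G.Site) :
    ∑ y'' : G.Site, r * Real.exp (-((1 - α) * δ₀ * G.dist a y'')) * (A * Real.exp (-(δ₀ * G.dist y'' c))) ≤
      r * A * B6.c1 d δ₀ α * Real.exp (-((1 - α) * δ₀ * G.dist a c)) := by
  have hterm : ∀ y'' : G.Site,
      r * Real.exp (-((1 - α) * δ₀ * G.dist a y'')) * (A * Real.exp (-(δ₀ * G.dist y'' c))) ≤
        r * A * Real.exp (-((1 - α) * δ₀ * G.dist a c)) * Real.exp (-(α * δ₀ * G.dist c y'')) := by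
    intro y''
    have hexp : Real.exp (-((1 - α) * δ₀ * G.dist a y'')) * Real.exp (-(δ₀ * G.dist y'' c)) ≤
        Real.exp (-((1 - α) * δ₀ * G.dist a c)) * Real.exp (-(α * δ₀ * G.dist c y'')) := by
      rw [← Real.exp_add, ← Real.exp_add]
      refine Real.exp_le_exp.mpr ?_
      have h1 := mul_le_mul_of_nonneg_left (htri a y'' c) h1αδ
      have h2 : G.dist c y'' = G.dist y'' c := hsymm c y''
      rw [h2]
      nlinarith
    have := mul_le_mul_of_nonneg_left hexp (mul_nonneg hr hA)
    calc r * Real.exp (-((1 - α) * δ₀ * G.dist a y'')) * (A * Real.exp (-(δ₀ * G.dist y'' c)))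
        = r * A * (Real.exp (-((1 - α) * δ₀ * G.dist a y'')) * Real.exp (-(δ₀ * G.dist y'' c))) := by ring
      _ ≤ r * A * (Real.exp (-((1 - α) * δ₀ * G.dist a c)) * Real.exp (-(α * δ₀ * G.dist c y''))) := this
      _ = _ := by ring
  calc ∑ y'' : G.Site, r * Real.exp (-((1 - α) * δ₀ * G.dist a y'')) * (A * Real.exp (-(δ₀ * G.dist y'' c)))
      ≤ ∑ y'' : G.Site, r * A * Real.exp (-((1 - α) * δ₀ * G.dist a c)) * Real.exp (-(α * δ₀ * G.dist c y'')) :=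
        Finset.sum_le_sum fun y'' _ => hterm y''
    _ = r * A * Real.exp (-((1 - α) * δ₀ * G.dist a c)) * ∑ y'' : G.Site, Real.exp (-(α * δ₀ * G.dist c y'')) := by
        rw [Finset.mul_sum]
    _ ≤ r * A * Real.exp (-((1 - α) * δ₀ * G.dist a c)) * B6.c1 d δ₀ α :=
        mul_le_mul_of_nonneg_left (h261 c) (mul_nonneg (mul_nonneg hr hA) (Real.exp_nonneg _))
    _ = r * A * B6.c1 d δ₀ α * Real.exp (-((1 - α) * δ₀ * G.dist a c)) := by ring

end Tools

/-! ## §2  The LEFT Neumann series with conjugated weights: A₀ = S + VA₀ -/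

section NeumannLeft

variable {G : B6.Geometry}
variable {F₀ F₁ : Type} [AddCommGroup F₀] [Module ℝ F₀] [AddCommGroup F₁] [Module ℝ F₁]
set_option maxHeartbeats 400000 in
/-- **The left Neumann series over block norms, weights on both sides** (the transposed expansion of Theorem 3.7:
G′A = G′₀A + V(G′A), summed as Σₙ VⁿG′₀A).  Let A₀, S : F₀ → F₁ and V : F₁ → F₁ satisfy A₀ = S + VA₀, S with
majorant A·W(y)·Q(y′)·e^{−δ₀d(y,y′)} from `b₀` into `b₁` (W > 0 an output weight, Q ≥ 0 an input weight — p. 398: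
*"we may replace the factor (L^jη)^α by (L^jη)^β(L^{j′}η)^γ"*), V with the CONJUGATED majorant θ·(W(y)/W(y′))·e^{−δ₀d}
in `b₁` (the transposed (3.89): the coefficient kernels of K(h_□)ᵗ carry (L^{j′}η)^{−1}, (L^{j′}η)^{−2} against the
output powers of G′_□), Lemma 2.1 of [4] at α for a SYMMETRIC distance, κ₁θc₁(α) < 1 and an a-priori constant majorant
M₀ of A₀.  Then A₀ has majorant A·c₁(α)·(1 − κ₁θc₁(α))⁻¹·W(y)·Q(y′)·e^{−(1−α)δ₀d(y,y′)}: the conjugation telescopes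
along Vⁿ (`chain_conj`), (2.63) bounds the chain, one column convolution closes each term, the remainder VᴺA₀ → 0.
[cite: Balaban1985BackgroundPropagators, Thm 3.7 (3.90) pp.409–410, p.398 (remark); Balaban1984PropagatorsII, (2.64)–(2.66) p.234] -/
theorem neumann_left_weighted (b₀ : BlockNorm G F₀) (b₁ : BlockNorm G F₁) (d : ℕ) (δ₀ α θ A M₀ : ℝ)
    (W Q : G.Site → ℝ) {A0 S : F₀ →ₗ[ℝ] F₁} {V : Module.End ℝ F₁}
    (hA : 0 ≤ A) (hW : ∀ y, 0 < W y) (hQ : ∀ y, 0 ≤ Q y) (hθ : 0 ≤ θ) (hM₀ : 0 ≤ M₀) (hαδ : 0 ≤ α * δ₀)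
    (h1αδ : 0 ≤ (1 - α) * δ₀) (htri : Triangle254 G) (hrefl : ∀ y : G.Site, G.dist y y = 0)
    (hdnn : ∀ y y' : G.Site, 0 ≤ G.dist y y') (hsymm : ∀ a c : G.Site, G.dist a c = G.dist c a)
    (h261 : Ineq261 d G δ₀ α) (h263 : Ineq263 d G δ₀ α) (hsmall : b₁.κ * θ * B6.c1 d δ₀ α < 1)
    (hS : HasMaj b₀ b₁ S (fun a c => A * W a * Q c * Real.exp (-(δ₀ * G.dist a c))))
    (hV : HasMaj b₁ b₁ V (fun a c => θ * (W a / W c) * Real.exp (-(δ₀ * G.dist a c))))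
    (hfix : A0 = S + V ∘ₗ A0)
    (hap : HasMaj b₀ b₁ A0 (fun _ _ => M₀)) :
    HasMaj b₀ b₁ A0
      (fun a c => A * B6.c1 d δ₀ α * (1 - b₁.κ * θ * B6.c1 d δ₀ α)⁻¹ * W a * Q c *
        Real.exp (-((1 - α) * δ₀ * G.dist a c))) := by
  set cα : ℝ := B6.c1 d δ₀ α with hcα
  set q : ℝ := b₁.κ * θ * cα with hqdef
  have hc0 : 0 ≤ cα := c1_nonneg d δ₀ α
  have hq0 : 0 ≤ q := mul_nonneg (mul_nonneg b₁.κ_nonneg hθ) hc0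
  have hWne : ∀ y, W y ≠ 0 := fun y => (hW y).ne'
  have hWnn : ∀ y, 0 ≤ W y := fun y => (hW y).le
  have hrat : ∀ a c, 0 ≤ W a / W c := fun a c => div_nonneg (hWnn a) (hWnn c)
  by_cases hne : Nonempty G.Site
  swap
  · intro y' μ _ y
    exact (hne ⟨y⟩).elim
  have hc1 : 1 ≤ cα := one_le_c1_of_ineq261 d δ₀ α hrefl h261 (Classical.arbitrary _)
  -- (2.63) + telescoping: Vᵐ⁺¹ has majorant κ₁ᵐ(θc₁)ᵐ⁺¹(W y/W y′)e^{−(1−α)δ₀d}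
  have hVn : ∀ m : ℕ, HasMaj b₁ b₁ (V ^ (m + 1))
      (fun a c => b₁.κ ^ m * (θ * cα) ^ (m + 1) * (W a / W c) * Real.exp (-((1 - α) * δ₀ * G.dist a c))) := by
    intro m
    have hKnn : ∀ a c, 0 ≤ θ * (W a / W c) * Real.exp (-(δ₀ * G.dist a c)) := fun a c =>
      mul_nonneg (mul_nonneg hθ (hrat a c)) (Real.exp_nonneg _)
    refine (hasMaj_pow_chain b₁ hV hKnn m).mono fun a c => ?_
    have hrw : chain (fun a c => θ * (W a / W c) * Real.exp (-(δ₀ * G.dist a c))) m a c =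
        W a / W c * (θ ^ (m + 1) * chain (fun a c => Real.exp (-(δ₀ * G.dist a c))) m a c) := by
      have h1 : (fun a c => θ * (W a / W c) * Real.exp (-(δ₀ * G.dist a c))) =
          (fun a c => W a / W c * (θ * Real.exp (-(δ₀ * G.dist a c)))) := by
        funext a c; ring
      rw [h1, chain_conj W hWne, chain_const_mul]
    rw [hrw]
    have h263' := h263 m a c
    have hnn : 0 ≤ b₁.κ ^ m * (W a / W c) * θ ^ (m + 1) :=
      mul_nonneg (mul_nonneg (pow_nonneg b₁.κ_nonneg m) (hrat a c)) (pow_nonneg hθ _)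
    calc b₁.κ ^ m * (W a / W c * (θ ^ (m + 1) * chain (fun a c => Real.exp (-(δ₀ * G.dist a c))) m a c))
        = b₁.κ ^ m * (W a / W c) * θ ^ (m + 1) * chain (fun a c => Real.exp (-(δ₀ * G.dist a c))) m a c := by ring
      _ ≤ b₁.κ ^ m * (W a / W c) * θ ^ (m + 1) * (cα ^ (m + 1) * Real.exp (-((1 - α) * δ₀ * G.dist a c))) :=
          mul_le_mul_of_nonneg_left h263' hnn
      _ = _ := by rw [mul_pow]; ring
  -- the n-th term Vⁿ S has majorant A c₁ W(y) Q(y′) qⁿ e^{−(1−α)δ₀d}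
  have hterm : ∀ n : ℕ, HasMaj b₀ b₁ ((V ^ n) ∘ₗ S)
      (fun a c => A * cα * W a * Q c * q ^ n * Real.exp (-((1 - α) * δ₀ * G.dist a c))) := by
    intro n
    cases n with
    | zero =>
        refine (hS.congr fun μ => ?_).mono fun a c => ?_
        · rw [LinearMap.comp_apply, pow_zero, Module.End.one_apply]
        · have hexp : Real.exp (-(δ₀ * G.dist a c)) ≤ Real.exp (-((1 - α) * δ₀ * G.dist a c)) := by
            refine Real.exp_le_exp.mpr ?_
            have := mul_nonneg hαδ (hdnn a c)
            nlinarith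
          have hAWQ : 0 ≤ A * W a * Q c := mul_nonneg (mul_nonneg hA (hWnn a)) (hQ c)
          have h2 : 0 ≤ W a * Q c * q ^ 0 * Real.exp (-((1 - α) * δ₀ * G.dist a c)) :=
            mul_nonneg (mul_nonneg (mul_nonneg (hWnn a) (hQ c)) (pow_nonneg hq0 0)) (Real.exp_nonneg _)
          calc A * W a * Q c * Real.exp (-(δ₀ * G.dist a c))
              ≤ A * W a * Q c * Real.exp (-((1 - α) * δ₀ * G.dist a c)) := mul_le_mul_of_nonneg_left hexp hAWQ
            _ = A * 1 * (W a * Q c * q ^ 0 * Real.exp (-((1 - α) * δ₀ * G.dist a c))) := by ring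
            _ ≤ A * cα * (W a * Q c * q ^ 0 * Real.exp (-((1 - α) * δ₀ * G.dist a c))) :=
                mul_le_mul_of_nonneg_right (mul_le_mul_of_nonneg_left hc1 hA) h2
            _ = _ := by ring
    | succ m =>
        have hK₁ : ∀ a c, 0 ≤ b₁.κ ^ m * (θ * cα) ^ (m + 1) * (W a / W c) *
            Real.exp (-((1 - α) * δ₀ * G.dist a c)) := fun a c =>
          mul_nonneg (mul_nonneg (mul_nonneg (pow_nonneg b₁.κ_nonneg m) (pow_nonneg (mul_nonneg hθ hc0) _))
            (hrat a c)) (Real.exp_nonneg _)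
        have h := hasMaj_comp (hVn m) hS hK₁
        refine h.mono fun a c => ?_
        have hq' : b₁.κ * (b₁.κ ^ m * (θ * cα) ^ (m + 1)) = q ^ (m + 1) := by rw [hqdef]; ring
        have hr : 0 ≤ b₁.κ ^ m * (θ * cα) ^ (m + 1) * W a * b₁.κ :=
          mul_nonneg (mul_nonneg (mul_nonneg (pow_nonneg b₁.κ_nonneg m) (pow_nonneg (mul_nonneg hθ hc0) _))
            (hWnn a)) b₁.κ_nonneg
        have hconv := conv_weight_col_le d δ₀ α (b₁.κ ^ m * (θ * cα) ^ (m + 1) * W a * b₁.κ) (A * Q c) hr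
          (mul_nonneg hA (hQ c)) h1αδ htri hsymm h261 a c
        calc ∑ y'', b₁.κ ^ m * (θ * cα) ^ (m + 1) * (W a / W y'') * Real.exp (-((1 - α) * δ₀ * G.dist a y'')) *
              (b₁.κ * (A * W y'' * Q c * Real.exp (-(δ₀ * G.dist y'' c))))
            = ∑ y'', b₁.κ ^ m * (θ * cα) ^ (m + 1) * W a * b₁.κ * Real.exp (-((1 - α) * δ₀ * G.dist a y'')) *
              (A * Q c * Real.exp (-(δ₀ * G.dist y'' c))) := by
              refine Finset.sum_congr rfl fun y'' _ => ?_
              have hy := hWne y''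
              field_simp
          _ ≤ b₁.κ ^ m * (θ * cα) ^ (m + 1) * W a * b₁.κ * (A * Q c) * cα *
              Real.exp (-((1 - α) * δ₀ * G.dist a c)) := hconv
          _ = A * cα * W a * Q c * (b₁.κ * (b₁.κ ^ m * (θ * cα) ^ (m + 1))) *
              Real.exp (-((1 - α) * δ₀ * G.dist a c)) := by ring
          _ = A * cα * W a * Q c * q ^ (m + 1) * Real.exp (-((1 - α) * δ₀ * G.dist a c)) := by rw [hq']
  -- partial sums
  have hpartial : ∀ N : ℕ, HasMaj b₀ b₁ (∑ n ∈ Finset.range N, (V ^ n) ∘ₗ S)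
      (fun a c => ∑ n ∈ Finset.range N,
        A * cα * W a * Q c * q ^ n * Real.exp (-((1 - α) * δ₀ * G.dist a c))) :=
    fun N => hasMaj_sum (fun n => (V ^ n) ∘ₗ S) _ hterm N
  -- the remainder Vᴺ A₀: majorant (1 + W(y)·Σ_{y″}W(y″)⁻¹)·M₀·qᴺ
  set SI : ℝ := ∑ y'' : G.Site, (W y'')⁻¹ with hSI
  have hSI0 : 0 ≤ SI := Finset.sum_nonneg fun y'' _ => (inv_pos.mpr (hW y'')).le
  have hrem : ∀ N : ℕ, HasMaj b₀ b₁ ((V ^ N) ∘ₗ A0) (fun a _ => (1 + W a * SI) * M₀ * q ^ N) := by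
    intro N
    cases N with
    | zero =>
        refine (hap.congr fun μ => ?_).mono fun a c => ?_
        · rw [LinearMap.comp_apply, pow_zero, Module.End.one_apply]
        · rw [pow_zero, mul_one]
          have : 0 ≤ W a * SI := mul_nonneg (hWnn a) hSI0
          nlinarith
    | succ m =>
        have hK₁ : ∀ a c, 0 ≤ b₁.κ ^ m * (θ * cα) ^ (m + 1) * (W a / W c) *
            Real.exp (-((1 - α) * δ₀ * G.dist a c)) := fun a c =>
          mul_nonneg (mul_nonneg (mul_nonneg (pow_nonneg b₁.κ_nonneg m) (pow_nonneg (mul_nonneg hθ hc0) _))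
            (hrat a c)) (Real.exp_nonneg _)
        have h := hasMaj_comp (hVn m) hap hK₁
        refine h.mono fun a c => ?_
        have hq' : b₁.κ * (b₁.κ ^ m * (θ * cα) ^ (m + 1)) = q ^ (m + 1) := by rw [hqdef]; ring
        have hle : ∀ y'' : G.Site, b₁.κ ^ m * (θ * cα) ^ (m + 1) * (W a / W y'') *
            Real.exp (-((1 - α) * δ₀ * G.dist a y'')) * (b₁.κ * M₀) ≤ q ^ (m + 1) * M₀ * W a * (W y'')⁻¹ := by
          intro y''
          have hexp : Real.exp (-((1 - α) * δ₀ * G.dist a y'')) ≤ 1 := by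
            rw [Real.exp_le_one_iff]
            have := mul_nonneg h1αδ (hdnn a y'')
            linarith
          have hbase : 0 ≤ b₁.κ ^ m * (θ * cα) ^ (m + 1) * (W a / W y'') * (b₁.κ * M₀) :=
            mul_nonneg (mul_nonneg (mul_nonneg (pow_nonneg b₁.κ_nonneg m) (pow_nonneg (mul_nonneg hθ hc0) _))
              (hrat a y'')) (mul_nonneg b₁.κ_nonneg hM₀)
          calc b₁.κ ^ m * (θ * cα) ^ (m + 1) * (W a / W y'') * Real.exp (-((1 - α) * δ₀ * G.dist a y'')) *
                (b₁.κ * M₀)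
              = b₁.κ ^ m * (θ * cα) ^ (m + 1) * (W a / W y'') * (b₁.κ * M₀) *
                  Real.exp (-((1 - α) * δ₀ * G.dist a y'')) := by ring
            _ ≤ b₁.κ ^ m * (θ * cα) ^ (m + 1) * (W a / W y'') * (b₁.κ * M₀) * 1 :=
                mul_le_mul_of_nonneg_left hexp hbase
            _ = (b₁.κ * (b₁.κ ^ m * (θ * cα) ^ (m + 1))) * M₀ * W a * (W y'')⁻¹ := by
                rw [div_eq_mul_inv]; ring
            _ = q ^ (m + 1) * M₀ * W a * (W y'')⁻¹ := by rw [hq']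
        calc ∑ y'', b₁.κ ^ m * (θ * cα) ^ (m + 1) * (W a / W y'') * Real.exp (-((1 - α) * δ₀ * G.dist a y'')) *
              (b₁.κ * M₀)
            ≤ ∑ y'', q ^ (m + 1) * M₀ * W a * (W y'')⁻¹ := Finset.sum_le_sum fun y'' _ => hle y''
          _ = W a * SI * M₀ * q ^ (m + 1) := by
              rw [hSI, Finset.mul_sum, Finset.sum_mul, Finset.sum_mul]
              exact Finset.sum_congr rfl fun _ _ => by ring
          _ ≤ (1 + W a * SI) * M₀ * q ^ (m + 1) := by
              have : 0 ≤ M₀ * q ^ (m + 1) := mul_nonneg hM₀ (pow_nonneg hq0 _)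
              nlinarith
  -- pointwise, then N → ∞
  intro y' μ hμ y
  set ℓ : ℝ := b₀.loc y' μ with hℓ
  have hℓ0 : 0 ≤ ℓ := b₀.loc_nonneg y' μ
  set C : ℝ := A * cα * (1 - q)⁻¹ * W y * Q y' * Real.exp (-((1 - α) * δ₀ * G.dist y y')) * ℓ with hC
  have hgeomC : ∀ N : ℕ, (∑ n ∈ Finset.range N,
      A * cα * W y * Q y' * q ^ n * Real.exp (-((1 - α) * δ₀ * G.dist y y'))) * ℓ ≤ C := by
    intro N
    have hgeom : ∑ n ∈ Finset.range N, q ^ n ≤ (1 - q)⁻¹ :=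
      sum_le_hasSum (Finset.range N) (fun n _ => pow_nonneg hq0 n) (hasSum_geometric_of_lt_one hq0 hsmall)
    have hnn : 0 ≤ A * cα * W y * Q y' * Real.exp (-((1 - α) * δ₀ * G.dist y y')) * ℓ :=
      mul_nonneg (mul_nonneg (mul_nonneg (mul_nonneg (mul_nonneg hA hc0) (hWnn y)) (hQ y')) (Real.exp_nonneg _))
        hℓ0
    calc (∑ n ∈ Finset.range N, A * cα * W y * Q y' * q ^ n * Real.exp (-((1 - α) * δ₀ * G.dist y y'))) * ℓ
        = (∑ n ∈ Finset.range N, q ^ n) *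
            (A * cα * W y * Q y' * Real.exp (-((1 - α) * δ₀ * G.dist y y')) * ℓ) := by
          rw [Finset.sum_mul, Finset.sum_mul]; exact Finset.sum_congr rfl fun n _ => by ring
      _ ≤ (1 - q)⁻¹ * (A * cα * W y * Q y' * Real.exp (-((1 - α) * δ₀ * G.dist y y')) * ℓ) :=
          mul_le_mul_of_nonneg_right hgeom hnn
      _ = C := by rw [hC]; ring
  have hN : ∀ N : ℕ, b₁.loc y (A0 μ) ≤ C + (1 + W y * SI) * M₀ * ℓ * q ^ N := by
    intro N
    rw [neumann_telescope hfix N μ]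
    refine (b₁.loc_add_le y _ _).trans (add_le_add ?_ ?_)
    · have h1 := hpartial N y' μ hμ y
      rw [LinearMap.sum_apply] at h1
      simp only [LinearMap.comp_apply] at h1
      exact h1.trans (hgeomC N)
    · have h2 := hrem N y' μ hμ y
      rw [LinearMap.comp_apply] at h2
      calc b₁.loc y ((V ^ N) (A0 μ)) ≤ (1 + W y * SI) * M₀ * q ^ N * ℓ := h2
        _ = (1 + W y * SI) * M₀ * ℓ * q ^ N := by ring
  have hlim : Filter.Tendsto (fun N : ℕ => C + (1 + W y * SI) * M₀ * ℓ * q ^ N) Filter.atTop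
      (nhds (C + (1 + W y * SI) * M₀ * ℓ * 0)) :=
    ((tendsto_pow_atTop_nhds_zero_of_lt_one hq0 hsmall).const_mul ((1 + W y * SI) * M₀ * ℓ)).const_add C
  rw [mul_zero, add_zero] at hlim
  have := ge_of_tendsto' hlim hN
  simpa [hC, hqdef, hcα, mul_assoc] using this

end NeumannLeft

/-! ## §3  Theorem 3.7 for a RIGHT member, arbitrary block norms at both ends -/

section Thm37Right

variable {G : B6.Geometry} [DecidableEq G.Site]
variable {F₀ F₁ : Type} [AddCommGroup F₀] [Module ℝ F₀] [AddCommGroup F₁] [Module ℝ F₁]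

/-- **THEOREM 3.7 ⇒ a RIGHT member of (3.42)–(3.47) for G′, from `b₀` into `b₁`** (p. 409: *"The expansion is
convergent in all norms appearing in the inequalities (3.42)–(3.47)"*; (3.42)₃ G′∇*_U, (3.46)₃ ‖hG′∇*_Uλ‖, the p. 398
remark on ∇_U ↔ ∇*_U and on moving powers of L^jη between the two localizations), along the TRANSPOSED expansion
G′ = G′₀ + VG′ of `…B9Thm37Glue` v4.  Data: A : F₀ → F₁ (A = ∇*_U from bond functions; A = 1 with another input size),
block norms `b₀` on F₀ and `b₁` on F₁, the terms T_□ = h_□G′_□h_□ of (3.87) and V_□ = h_□G′_□K(h_□)ᵗ of the transposed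
(3.88), weights W > 0 (output) and Q ≥ 0 (input).  Hypotheses (printed shape, named): `hlegR` — the A-member of
Corollary 3.6 for G′_□ carried by the leg T_□A, localized by the left factor h_□ to S_□ (majorant
1_{S_□}(y)AW(y)Q(y′)e^{−δ₀d}); `hV` — the transposed (3.89): V_□ has majorant 1_{S_□}(y)θ(W(y)/W(y′))e^{−δ₀d} in `b₁`
(`B9Thm37Glue.rightR_cube_majorant` in the sup sizes, after the cube comparability); overlap ≤ N (`hcnt`); `hinvT`
Δ′_aG′ = I and `h388T` (Σ_□T_□)Δ′_a = I − Σ_□V_□; Lemma 2.1 of [4] at α, d symmetric; κ₁Nθc₁(α) < 1; `hap` an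
a-priori constant majorant of G′A.  Conclusion: G′A has majorant NAc₁(α)(1 − κ₁Nθc₁(α))⁻¹W(y)Q(y′)e^{−(1−α)δ₀d(y,y′)}
from `b₀` into `b₁`. [cite: Balaban1985BackgroundPropagators, Thm 3.7 (3.87)–(3.90) pp.409–410, (3.42) p.397, p.398; Balaban1984PropagatorsII, Prop. 2.2 (2.64)–(2.67) p.234] -/
theorem thm37_right (b₀ : BlockNorm G F₀) (b₁ : BlockNorm G F₁) (Aop : F₀ →ₗ[ℝ] F₁) (d : ℕ)
    (δ₀ α θ A N M₀ : ℝ) (W Q : G.Site → ℝ) {ι : Type} [Fintype ι] (S : ι → Finset G.Site)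
    (Tl Vl : ι → Module.End ℝ F₁) {G' Δ : Module.End ℝ F₁}
    (hA : 0 ≤ A) (hW : ∀ y, 0 < W y) (hQ : ∀ y, 0 ≤ Q y) (hθ : 0 ≤ θ) (hN : 0 ≤ N) (hM₀ : 0 ≤ M₀)
    (hαδ : 0 ≤ α * δ₀) (h1αδ : 0 ≤ (1 - α) * δ₀) (htri : Triangle254 G) (hrefl : ∀ y : G.Site, G.dist y y = 0)
    (hdnn : ∀ y y' : G.Site, 0 ≤ G.dist y y') (hsymm : ∀ a c : G.Site, G.dist a c = G.dist c a)
    (h261 : Ineq261 d G δ₀ α) (h263 : Ineq263 d G δ₀ α) (hsmall : b₁.κ * (N * θ) * B6.c1 d δ₀ α < 1)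
    (hlegR : ∀ i, HasMaj b₀ b₁ (Tl i ∘ₗ Aop)
      (fun a c => if a ∈ S i then A * W a * Q c * Real.exp (-(δ₀ * G.dist a c)) else 0))
    (hV : ∀ i, HasMaj b₁ b₁ (Vl i)
      (fun a c => if a ∈ S i then θ * (W a / W c) * Real.exp (-(δ₀ * G.dist a c)) else 0))
    (hcnt : ∀ a : G.Site, (∑ i, if a ∈ S i then (1 : ℝ) else 0) ≤ N)
    (hinvT : Δ * G' = 1) (h388T : (∑ i, Tl i) * Δ = 1 - ∑ i, Vl i)
    (hap : HasMaj b₀ b₁ (G' ∘ₗ Aop) (fun _ _ => M₀)) :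
    HasMaj b₀ b₁ (G' ∘ₗ Aop)
      (fun a c => N * A * B6.c1 d δ₀ α * (1 - b₁.κ * (N * θ) * B6.c1 d δ₀ α)⁻¹ * W a * Q c *
        Real.exp (-((1 - α) * δ₀ * G.dist a c))) := by
  have hWnn : ∀ y, 0 ≤ W y := fun y => (hW y).le
  -- G′₀A = Σ_□ T_□A: majorant N·A·W(y)Q(y′)e^{−δ₀d}
  have hleg' : ∀ i, HasMaj b₀ b₁ (Tl i ∘ₗ Aop)
      (fun a c => (if a ∈ S i then (1 : ℝ) else 0) * (A * W a * Q c * Real.exp (-(δ₀ * G.dist a c)))) :=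
    fun i => (hlegR i).mono fun a c => le_of_eq (by split_ifs <;> simp)
  have hS₀ : HasMaj b₀ b₁ (∑ i, Tl i ∘ₗ Aop) (fun a c => N * (A * W a * Q c * Real.exp (-(δ₀ * G.dist a c)))) :=
    hasMaj_localSum (fun i => Tl i ∘ₗ Aop) (fun i a => if a ∈ S i then (1 : ℝ) else 0) _ N
      (fun a c => mul_nonneg (mul_nonneg (mul_nonneg hA (hWnn a)) (hQ c)) (Real.exp_nonneg _)) hleg' hcnt
  have hS : HasMaj b₀ b₁ ((∑ i, Tl i) ∘ₗ Aop) (fun a c => N * A * W a * Q c * Real.exp (-(δ₀ * G.dist a c))) := by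
    refine (hS₀.congr fun μ => ?_).mono fun a c => le_of_eq (by ring)
    rw [LinearMap.sum_apply, LinearMap.comp_apply, LinearMap.sum_apply]
    rfl
  -- V = Σ_□ V_□: majorant Nθ(W y/W y′)e^{−δ₀d}
  have hV' : ∀ i, HasMaj b₁ b₁ (Vl i)
      (fun a c => (if a ∈ S i then (1 : ℝ) else 0) * (θ * (W a / W c) * Real.exp (-(δ₀ * G.dist a c)))) :=
    fun i => (hV i).mono fun a c => le_of_eq (by split_ifs <;> simp)
  have hVs : HasMaj b₁ b₁ (∑ i, Vl i) (fun a c => N * θ * (W a / W c) * Real.exp (-(δ₀ * G.dist a c))) := by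
    have h := hasMaj_localSum Vl (fun i a => if a ∈ S i then (1 : ℝ) else 0)
      (fun a c => θ * (W a / W c) * Real.exp (-(δ₀ * G.dist a c))) N
      (fun a c => mul_nonneg (mul_nonneg hθ (div_nonneg (hWnn a) (hWnn c))) (Real.exp_nonneg _)) hV' hcnt
    exact h.mono fun a c => le_of_eq (by ring)
  -- the transposed fixed point: G′ = G′₀ + VG′, composed with A
  have hfix : G' = (∑ i, Tl i) + (∑ i, Vl i) * G' := B9Thm37Glue.fixedPoint_of_388T hinvT h388T
  have hfixA : G' ∘ₗ Aop = (∑ i, Tl i) ∘ₗ Aop + (∑ i, Vl i) ∘ₗ (G' ∘ₗ Aop) := by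
    conv_lhs => rw [hfix]
    rw [LinearMap.add_comp, Module.End.mul_eq_comp, LinearMap.comp_assoc]
  have hmain := neumann_left_weighted b₀ b₁ d δ₀ α (N * θ) (N * A) M₀ W Q (mul_nonneg hN hA) hW hQ
    (mul_nonneg hN hθ) hM₀ hαδ h1αδ htri hrefl hdnn hsymm h261 h263 hsmall hS hVs hfixA hap
  refine hmain.mono fun a c => le_of_eq ?_
  ring

/-- **"For M sufficiently large", made a number, right member**: with O(M⁻¹) = θ₀M⁻¹ in the transposed (3.89) and
M ≥ 2κ₁Nθ₀c₁(α), G′A has majorant 2NAc₁(α)W(y)Q(y′)e^{−(1−α)δ₀d(y,y′)} — the A-member of (3.42)–(3.47) for G′ with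
constant 2NAc₁(α) and rate (1 − α)δ₀. [cite: Balaban1985BackgroundPropagators, Thm 3.1 p.397 + Thm 3.7 pp.409–410] -/
theorem thm37_right_explicit (b₀ : BlockNorm G F₀) (b₁ : BlockNorm G F₁) (Aop : F₀ →ₗ[ℝ] F₁) (d : ℕ)
    (δ₀ α θ₀ A N M₀ : ℝ) (W Q : G.Site → ℝ) {ι : Type} [Fintype ι] (S : ι → Finset G.Site)
    (Tl Vl : ι → Module.End ℝ F₁) {G' Δ : Module.End ℝ F₁}
    (hA : 0 ≤ A) (hW : ∀ y, 0 < W y) (hQ : ∀ y, 0 ≤ Q y) (hθ₀ : 0 < θ₀) (hN : 0 ≤ N) (hM₀ : 0 ≤ M₀)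
    (hαδ : 0 ≤ α * δ₀) (h1αδ : 0 ≤ (1 - α) * δ₀) (hc₁ : 0 < B6.c1 d δ₀ α) (hM : 0 < G.M)
    (hM₂ : 2 * b₁.κ * N * θ₀ * B6.c1 d δ₀ α ≤ G.M)
    (htri : Triangle254 G) (hrefl : ∀ y : G.Site, G.dist y y = 0)
    (hdnn : ∀ y y' : G.Site, 0 ≤ G.dist y y') (hsymm : ∀ a c : G.Site, G.dist a c = G.dist c a)
    (h261 : Ineq261 d G δ₀ α) (h263 : Ineq263 d G δ₀ α)
    (hlegR : ∀ i, HasMaj b₀ b₁ (Tl i ∘ₗ Aop)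
      (fun a c => if a ∈ S i then A * W a * Q c * Real.exp (-(δ₀ * G.dist a c)) else 0))
    (hV : ∀ i, HasMaj b₁ b₁ (Vl i)
      (fun a c => if a ∈ S i then θ₀ * G.M⁻¹ * (W a / W c) * Real.exp (-(δ₀ * G.dist a c)) else 0))
    (hcnt : ∀ a : G.Site, (∑ i, if a ∈ S i then (1 : ℝ) else 0) ≤ N)
    (hinvT : Δ * G' = 1) (h388T : (∑ i, Tl i) * Δ = 1 - ∑ i, Vl i)
    (hap : HasMaj b₀ b₁ (G' ∘ₗ Aop) (fun _ _ => M₀)) :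
    HasMaj b₀ b₁ (G' ∘ₗ Aop)
      (fun a c => 2 * N * A * B6.c1 d δ₀ α * W a * Q c * Real.exp (-((1 - α) * δ₀ * G.dist a c))) := by
  set cα : ℝ := B6.c1 d δ₀ α with hcdef
  have hθ : 0 ≤ θ₀ * G.M⁻¹ := mul_nonneg hθ₀.le (inv_nonneg.mpr hM.le)
  have hq : b₁.κ * (N * (θ₀ * G.M⁻¹)) * cα ≤ 1 / 2 := by
    have h1 : b₁.κ * (N * (θ₀ * G.M⁻¹)) * cα = (b₁.κ * N * θ₀ * cα) / G.M := by
      rw [div_eq_mul_inv]; ring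
    rw [h1, div_le_iff₀ hM]
    linarith
  have hsmall : b₁.κ * (N * (θ₀ * G.M⁻¹)) * cα < 1 := by linarith
  have hinv' : (1 - b₁.κ * (N * (θ₀ * G.M⁻¹)) * cα)⁻¹ ≤ 2 := by
    rw [inv_le_comm₀ (by linarith) (by norm_num : (0 : ℝ) < 2)]
    linarith
  have h := thm37_right b₀ b₁ Aop d δ₀ α (θ₀ * G.M⁻¹) A N M₀ W Q S Tl Vl hA hW hQ hθ hN hM₀ hαδ h1αδ htri hrefl hdnn
    hsymm h261 h263 hsmall hlegR hV hcnt hinvT h388T hap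
  refine h.mono fun a c => ?_
  have hE : 0 ≤ W a * Q c * Real.exp (-((1 - α) * δ₀ * G.dist a c)) :=
    mul_nonneg (mul_nonneg (hW a).le (hQ c)) (Real.exp_nonneg _)
  have hNAc : 0 ≤ N * A * cα := mul_nonneg (mul_nonneg hN hA) hc₁.le
  have key : N * A * cα * (1 - b₁.κ * (N * (θ₀ * G.M⁻¹)) * cα)⁻¹ ≤ 2 * N * A * cα := by
    calc N * A * cα * (1 - b₁.κ * (N * (θ₀ * G.M⁻¹)) * cα)⁻¹ ≤ N * A * cα * 2 :=
          mul_le_mul_of_nonneg_left hinv' hNAc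
      _ = 2 * N * A * cα := by ring
  calc N * A * cα * (1 - b₁.κ * (N * (θ₀ * G.M⁻¹)) * cα)⁻¹ * W a * Q c * Real.exp (-((1 - α) * δ₀ * G.dist a c))
      = N * A * cα * (1 - b₁.κ * (N * (θ₀ * G.M⁻¹)) * cα)⁻¹ *
          (W a * Q c * Real.exp (-((1 - α) * δ₀ * G.dist a c))) := by ring
    _ ≤ 2 * N * A * cα * (W a * Q c * Real.exp (-((1 - α) * δ₀ * G.dist a c))) :=
        mul_le_mul_of_nonneg_right key hE
    _ = _ := by ring

end Thm37Right

/-! ## §4  The transposed walk: products and the walk count with weights on both sides -/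

section WalkRight

variable {G : B6.Geometry} [DecidableEq G.Site]
variable {X : Type} {F₀ : Type} [AddCommGroup F₀] [Module ℝ F₀]

omit [DecidableEq G.Site] in
/-- **(3.91) for the transposed walk**: a product F₀F₁⋯F_m of V-factors (majorants Kᵢ ≥ 0 in `b₁`, lattice functions
F₁ = X → ℝ) followed by the leg T₀A from `b₀` (majorant K_leg) has majorant
κ₁^{m+1}·Σ_z [Σ_{y₁…y_m}K₀(y,y₁)⋯K_m(y_m,z)]·K_leg(z,y′) — `hasMaj_lprod` and one more insertion of the partition of
unity. [cite: Balaban1985BackgroundPropagators, (3.91) p.410] -/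
theorem hasMaj_lprod_right (b₀ : BlockNorm G F₀) (b₁ : BlockNorm G (X → ℝ)) (Fs : ℕ → Module.End ℝ (X → ℝ))
    (K : ℕ → G.Site → G.Site → ℝ) (TA : F₀ →ₗ[ℝ] (X → ℝ)) (Kleg : G.Site → G.Site → ℝ) (m : ℕ)
    (hF : ∀ i ≤ m, HasMaj b₁ b₁ (Fs i) (K i)) (hK : ∀ i ≤ m, ∀ a c, 0 ≤ K i a c)
    (hleg : HasMaj b₀ b₁ TA Kleg) :
    HasMaj b₀ b₁ (lprod Fs m ∘ₗ TA)
      (fun a c => b₁.κ ^ (m + 1) * ∑ z : G.Site, lchain K m a z * Kleg z c) := by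
  have hprod := hasMaj_lprod b₁ Fs K m hF hK
  have hc := hasMaj_comp hprod hleg (fun a c => mul_nonneg (pow_nonneg b₁.κ_nonneg m)
    (lchain_nonneg m K hK a c))
  refine hc.mono fun a c => le_of_eq ?_
  rw [pow_succ, Finset.mul_sum]
  exact Finset.sum_congr rfl fun z _ => by ring

/-- **THE SUM OVER WALKS with weights on both sides** (Proposition 1.2 [3] route; p. 410 *"We will use the factor
O(M^{−1/2}) to control the sum over random walks ω"*): as `B9Thm37AllNorms.walkSum_left`, for terms EW ω with the
(3.94)-type majorants 1_{S_{□₀}}(y)AW(y)Q(y′)qⁿe^{−δ′d(y,y′)} from `b₀` into `b₁` (ω ∈ `walksFrom nbrs n □₀`, ≤ Dⁿ of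
them), overlap ≤ N and Dq ≤ ½: every partial sum has majorant 2NAW(y)Q(y′)e^{−δ′d(y,y′)}.
[cite: Balaban1985BackgroundPropagators, Thm 3.7/Cor. 3.8 pp.409–410; Balaban1984PropagatorsI, Prop. 1.2 p.35] -/
theorem walkSum_weighted {F₁ : Type} [AddCommGroup F₁] [Module ℝ F₁] (b₀ : BlockNorm G F₀) (b₁ : BlockNorm G F₁)
    {ι : Type} [Fintype ι] [DecidableEq ι] (nbrs : ι → Finset ι) (D : ℕ) (hD : ∀ c, (nbrs c).card ≤ D)
    (S : ι → Finset G.Site) (EW : List ι → F₀ →ₗ[ℝ] F₁) (A q δ' N : ℝ) (Wt Q : G.Site → ℝ) (hA : 0 ≤ A)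
    (hWt : ∀ y, 0 ≤ Wt y) (hQ : ∀ y, 0 ≤ Q y) (hq : 0 ≤ q) (hN : 0 ≤ N) (hDq : (D : ℝ) * q ≤ 1 / 2)
    (hW : ∀ (n : ℕ) (c : ι), ∀ ω ∈ walksFrom nbrs n c,
      HasMaj b₀ b₁ (EW ω)
        (fun a e => (if a ∈ S c then A * Wt a else 0) * Q e * q ^ n * Real.exp (-(δ' * G.dist a e))))
    (hcnt : ∀ a : G.Site, (∑ c, if a ∈ S c then (1 : ℝ) else 0) ≤ N) (m : ℕ) :
    HasMaj b₀ b₁ (∑ n ∈ Finset.range m, ∑ c, ∑ ω ∈ walksFrom nbrs n c, EW ω)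
      (fun a e => 2 * N * A * Wt a * Q e * Real.exp (-(δ' * G.dist a e))) := by
  have hlevel : ∀ n c, HasMaj b₀ b₁ (∑ ω ∈ walksFrom nbrs n c, EW ω)
      (fun a e => (D : ℝ) ^ n *
        ((if a ∈ S c then A * Wt a else 0) * Q e * q ^ n * Real.exp (-(δ' * G.dist a e)))) := by
    intro n c
    refine (hasMaj_finsetSum (walksFrom nbrs n c) EW
        (fun _ a e => (if a ∈ S c then A * Wt a else 0) * Q e * q ^ n * Real.exp (-(δ' * G.dist a e)))
        (hW n c)).mono fun a e => ?_
    have hnn : 0 ≤ (if a ∈ S c then A * Wt a else 0) * Q e * q ^ n * Real.exp (-(δ' * G.dist a e)) :=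
      mul_nonneg (mul_nonneg (mul_nonneg
        (by split_ifs <;> first | exact mul_nonneg hA (hWt a) | exact le_rfl) (hQ e))
        (pow_nonneg hq n)) (Real.exp_nonneg _)
    rw [Finset.sum_const, nsmul_eq_mul]
    refine mul_le_mul_of_nonneg_right ?_ hnn
    exact_mod_cast card_walksFrom_le nbrs hD n c
  have hn : ∀ n, HasMaj b₀ b₁ (∑ c, ∑ ω ∈ walksFrom nbrs n c, EW ω)
      (fun a e => N * A * Wt a * Q e * Real.exp (-(δ' * G.dist a e)) * ((D : ℝ) * q) ^ n) := by
    intro n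
    refine (hasMaj_finsetSum Finset.univ _ _ fun c _ => hlevel n c).mono fun a e => ?_
    have hE : 0 ≤ A * Wt a * Q e * Real.exp (-(δ' * G.dist a e)) * ((D : ℝ) * q) ^ n :=
      mul_nonneg (mul_nonneg (mul_nonneg (mul_nonneg hA (hWt a)) (hQ e)) (Real.exp_nonneg _))
        (pow_nonneg (mul_nonneg (Nat.cast_nonneg D) hq) n)
    calc ∑ c, (D : ℝ) ^ n * ((if a ∈ S c then A * Wt a else 0) * Q e * q ^ n * Real.exp (-(δ' * G.dist a e)))
        = (∑ c, if a ∈ S c then (1 : ℝ) else 0) *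
            (A * Wt a * Q e * Real.exp (-(δ' * G.dist a e)) * ((D : ℝ) * q) ^ n) := by
          rw [Finset.sum_mul]
          refine Finset.sum_congr rfl fun c _ => ?_
          split_ifs <;> ring
      _ ≤ N * (A * Wt a * Q e * Real.exp (-(δ' * G.dist a e)) * ((D : ℝ) * q) ^ n) :=
          mul_le_mul_of_nonneg_right (hcnt a) hE
      _ = _ := by ring
  refine (hasMaj_finsetSum (Finset.range m) _ _ fun n _ => hn n).mono fun a e => ?_
  have hC : 0 ≤ N * A * Wt a * Q e * Real.exp (-(δ' * G.dist a e)) :=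
    mul_nonneg (mul_nonneg (mul_nonneg (mul_nonneg hN hA) (hWt a)) (hQ e)) (Real.exp_nonneg _)
  have hgeom := B9.walkSum_le (N * A * Wt a * Q e * Real.exp (-(δ' * G.dist a e))) ((D : ℝ) * q)
    (fun _ => 1) (fun n => N * A * Wt a * Q e * Real.exp (-(δ' * G.dist a e)) * ((D : ℝ) * q) ^ n) hC
    (mul_nonneg (Nat.cast_nonneg D) hq) hDq (fun n => le_of_eq (one_mul _)) m
  calc ∑ n ∈ Finset.range m, N * A * Wt a * Q e * Real.exp (-(δ' * G.dist a e)) * ((D : ℝ) * q) ^ n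
      = ∑ n ∈ Finset.range m, 1 * (N * A * Wt a * Q e * Real.exp (-(δ' * G.dist a e)) * ((D : ℝ) * q) ^ n) := by
        simp only [one_mul]
    _ ≤ 2 * (N * A * Wt a * Q e * Real.exp (-(δ' * G.dist a e))) := hgeom
    _ = _ := by ring

end WalkRight

end

end Literature.MathematicalPhysics.QuantumFieldTheory.Balaban1983to89.B9Thm37AllNormsRight
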